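import Mathlib
import Summits.Schanuel.Schanuel.Theorems.RootDecomp1EAnchorToolkit
import Summits.Schanuel.Schanuel.Theses.RootDecomp1E
import Summits.Schanuel.Schanuel.Theorems.RootDecomp1EEStableRung
import Literature.Barriers.Schanuel.LargeTranscendenceDegree

-- `Summit.Schanuel.Schanuel.…` is the mandated layout of this single-problem summit (CONVENTIONS §1).
set_option linter.dupNamespace false

/-!
# RootDecomp1E — lens 2, gen 8 «ModuleGrids» (part 1/2: engines + the `n = 3` layer): grids in the EXPONENTIAL MODULE, not in the span

THEOREM ROUND on `route-Schanuel-RootDecomp1E` (no new items; refines the residual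
`RootDecomp1E.PlainDefectOne`, stmt-Schanuel-31410, at its first open length `n = 3`).

Round 7 («MultiplicationType») split `S⁻ = DefectOneSchanuel` by the multiplier field of the first failure
and proved (`Theorems.RootDecomp1EMultiplicationTypeLeavesGridBlind`) that a sub-minimal failure is BLIND to
every `(d,ℓ)`-grid lying IN ITS SPAN.  The structural point of round 8: the engines of
Brownawell–Waldschmidt / Theorem 2.9 do not need the grid in `span_ℚ z` — they need it in the
EXPONENTIAL MODULE of the field `K_z = ℚ(z, e^z)`,
`Λ(K_z) = {w : w and e^w are algebraic over K_z} ⊇ span_ℚ z`,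
which is strictly larger than the span at every non-saturated tuple.  A Brownawell–Waldschmidt
configuration `{l₁, l₂, μ l₁, μ l₂}` (`e^{l₁}, e^{l₂} ∈ ℚ̄`, `(l₁,l₂)` and `(1,μ)` ℚ-free) that is merely
ALGEBRAIC OVER `K_z` forces `trdeg K_z ≥ 2` (§1, the pair-level move of line `CardA_BW` of crux
`SchanuelTwo`, lifted to arbitrary length), and for a TRIPLE that is `S⁻`.

NEW DECIDED CELLS of `PlainDefectOne` (n = 3), outside round 7's grid-in-span families and NOT monotone
over any pair decided by the tree's `SchanuelTwo` sectors (§2–§4): the TWISTED LOG PAIRS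
`span_ℚ(m, μ l₁, μ l₂)` with `m ∈ span_ℚ(l₁, l₂) ∖ 0` — the fourth corner `l₂ = (μ l₂)/μ` lies in `Λ(K_z)`
but not in the span.  Certified instances (ℚ-free, PLAIN — indeed with no irrational multiplier at all —
and sub-minimal, i.e. genuine members of the hypothesis class of stmt-31410, on which its conclusion
is PROVED):
* `z♯ = (log 2, π·log 2, iπ²)`: two of `log 2, π, 2^π, e^{iπ²}` are algebraically independent;
* `z★ = (log 2, log 3, iπ·log 3/log 2)`: two of `log 2, log 3, π, e^{iπ log 3/log 2}` are algebraically
  independent — a decided triple over the famous OPEN pair `(log 2, log 3)`.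
All `mod` the tree THEOREM `smallTrdeg_thm_2_9_two_two` (Brownawell–Waldschmidt; discharged by
`smallTrdeg_thm_2_9_two_two_holds` / `BrownawellWaldschmidt.brownawell_waldschmidt`, hypothesis form only
because those cones were unbuilt on the farm at writing time, rc 75).

Contents: §0 arithmetic certificates (`π ∉ ℚ`, `log 3/log 2 ∉ ℚ` from `2^p ≠ 3^q`); §1 module form of
B–W richness `two_le_trdeg_of_bwModule`; §2 the twisted-log-pair cell `two_le_trdeg_of_twistedLogPair`
(+ `S⁻`-reading at length 3); §3 `z♯` and §4 `z★` are in part 2/2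
`Theorems.RootDecomp1EModuleGridsCells`; §5 module form of Theorem 2.9 (`t₂`) richness
`two_le_trdeg_of_t2Module`; §6 sub-minimality is automatic at length 3, so the `n = 3` layer of
stmt-31410 is `S⁻` on plain triples (`plainDefectOne_three_iff`); the PAIR CRITERION
`two_le_trdeg_three_iff_pairs`; and the layer follows from `SchanuelTwo` (stmt-0069):
convergence edge `RootDecomp1.SchanuelTwo ≽ PlainDefectOne(3)` (`defectOne_three_of_schanuelTwo`).
Sorry-free; axioms `propext`, `Classical.choice`, `Quot.sound`.
[cite: BakerTNT1975, Ch. 12 Theorem 12.2] [cite: NesterenkoPhilippon2001, Ch. 14 Theorem 2.9]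
-/

noncomputable section

namespace Summit.Schanuel.Schanuel.Theorems.RootDecomp1EModuleGrids

open Complex IntermediateField
open Summit.Schanuel.Schanuel.Theorems.RootDecomp1EAnchor (isAlgebraic_of_mem_adjoin
  trdeg_adjoin_le_of_isAlgebraic mem_adjoin_of_mem_span exp_isAlgebraic_of_mem_span trdeg_le_of_mem_span)
open Literature.Barriers.Schanuel (gridField₂ smallTrdeg_thm_2_9_pos smallTrdeg_thm_2_9_two_two trdeg_mono)
open Literature.NumberTheory.Transcendental (transcendental_exp_holds)
open Summit.Schanuel.Schanuel.Theorems.RootDecomp1EEStableRung (defectOne_of_le_two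
  one_le_trdeg_adjoin_of_transcendental)

/-! ## §0 Arithmetic certificates

DEDUP NOTE. The tree has `…Theorems.AclSubsetLogFreeCore.Negative.LogTwoBranchRelations.
linearIndependent_log_two_log_three_two_pi_I` (ℚ-freeness of `(log 2, log 3, 2πi)`, with the `2^a 3^b ≠ 1`
step INLINE) behind `Theses.RigidCore` + model-theory imports, and `irrational_log_ratCast` in
`Literature.Barriers.KontsevichZagierPeriods…`; neither states the two-term lemma below, and importing the
former into the 1E cone is not worth its imports, so the 15-line arithmetic is proved here. -/

/-- `t·π = r` with `t, r ∈ ℚ` forces `t = r = 0` (`π ∉ ℚ`, Mathlib `irrational_pi`). -/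
theorem rat_mul_pi_eq_rat {t r : ℚ} (h : (t : ℝ) * Real.pi = r) : t = 0 ∧ r = 0 := by
  by_cases ht : t = 0
  · subst ht
    simp only [Rat.cast_zero, zero_mul] at h
    exact ⟨rfl, by exact_mod_cast h.symm⟩
  · exfalso
    apply irrational_pi
    refine ⟨r / t, ?_⟩
    have ht' : (t : ℝ) ≠ 0 := by exact_mod_cast ht
    push_cast
    rw [div_eq_iff ht', ← h]
    ring

/-- `2^p = 3^q` in `ℕ` only for `p = q = 0`. -/
theorem two_pow_eq_three_pow {p q : ℕ} (h : 2 ^ p = 3 ^ q) : p = 0 ∧ q = 0 := by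
  rcases Nat.eq_zero_or_pos p with rfl | hp
  · refine ⟨rfl, ?_⟩
    rw [pow_zero] at h
    rcases Nat.eq_zero_or_pos q with rfl | hq
    · rfl
    · exfalso
      have : 3 ≤ 3 ^ q := by
        calc (3 : ℕ) = 3 ^ 1 := by norm_num
          _ ≤ 3 ^ q := Nat.pow_le_pow_right (by norm_num) hq
      omega
  · exfalso
    have h2 : 2 ∣ 3 ^ q := by
      rw [← h]
      exact dvd_pow_self 2 hp.ne'
    have h3 : 2 ∣ 3 := Nat.Prime.dvd_of_dvd_pow Nat.prime_two h2
    omega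

/-- `A·log 2 = B·log 3` with `A, B ∈ ℤ` forces `A = B = 0`. -/
theorem int_mul_log_two_eq_int_mul_log_three {A B : ℤ}
    (h : (A : ℝ) * Real.log 2 = (B : ℝ) * Real.log 3) : A = 0 ∧ B = 0 := by
  have h2 : (0 : ℝ) < Real.log 2 := Real.log_pos (by norm_num)
  have h3 : (0 : ℝ) < Real.log 3 := Real.log_pos (by norm_num)
  have e : ∀ z : ℤ, ((z.natAbs : ℕ) : ℝ) = |(z : ℝ)| := fun z => by
    rw [← Int.cast_natCast, Int.natCast_natAbs, Int.cast_abs]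
  have habs : ((A.natAbs : ℕ) : ℝ) * Real.log 2 = ((B.natAbs : ℕ) : ℝ) * Real.log 3 := by
    have := congrArg (fun t : ℝ => |t|) h
    simpa only [abs_mul, abs_of_pos h2, abs_of_pos h3, e] using this
  have hlog : Real.log ((2 : ℝ) ^ A.natAbs) = Real.log ((3 : ℝ) ^ B.natAbs) := by
    rw [Real.log_pow, Real.log_pow]
    exact habs
  have hpow : (2 : ℝ) ^ A.natAbs = (3 : ℝ) ^ B.natAbs :=
    Real.log_injOn_pos (Set.mem_Ioi.mpr (by positivity)) (Set.mem_Ioi.mpr (by positivity)) hlog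
  have hnat : 2 ^ A.natAbs = 3 ^ B.natAbs := by exact_mod_cast hpow
  obtain ⟨hA, hB⟩ := two_pow_eq_three_pow hnat
  exact ⟨Int.natAbs_eq_zero.mp hA, Int.natAbs_eq_zero.mp hB⟩

/-- `a·log 2 = b·log 3` with `a, b ∈ ℚ` forces `a = b = 0`: `log 3 / log 2 ∉ ℚ`. -/
theorem rat_mul_log_two_eq_rat_mul_log_three {a b : ℚ}
    (h : (a : ℝ) * Real.log 2 = (b : ℝ) * Real.log 3) : a = 0 ∧ b = 0 := by
  have ha : (a : ℝ) = (a.num : ℝ) / (a.den : ℝ) := by exact_mod_cast (Rat.num_div_den a).symm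
  have hb : (b : ℝ) = (b.num : ℝ) / (b.den : ℝ) := by exact_mod_cast (Rat.num_div_den b).symm
  have hda : (a.den : ℝ) ≠ 0 := by exact_mod_cast a.den_nz
  have hdb : (b.den : ℝ) ≠ 0 := by exact_mod_cast b.den_nz
  rw [ha, hb, div_mul_eq_mul_div, div_mul_eq_mul_div, div_eq_div_iff hda hdb] at h
  have h' : ((a.num * b.den : ℤ) : ℝ) * Real.log 2 = ((b.num * a.den : ℤ) : ℝ) * Real.log 3 := by
    push_cast
    linear_combination h
  obtain ⟨h1, h2⟩ := int_mul_log_two_eq_int_mul_log_three h'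
  have hbd : (b.den : ℤ) ≠ 0 := by exact_mod_cast b.den_nz
  have had : (a.den : ℤ) ≠ 0 := by exact_mod_cast a.den_nz
  have han : a.num = 0 := by
    rcases mul_eq_zero.mp h1 with h | h
    · exact h
    · exact absurd h hbd
  have hbn : b.num = 0 := by
    rcases mul_eq_zero.mp h2 with h | h
    · exact h
    · exact absurd h had
  exact ⟨Rat.num_eq_zero.mp han, Rat.num_eq_zero.mp hbn⟩

/-- Additive form: `a·log 2 + b·log 3 = 0` with `a, b ∈ ℚ` forces `a = b = 0`. -/
theorem rat_log_two_log_three_indep {a b : ℚ}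
    (h : (a : ℝ) * Real.log 2 + (b : ℝ) * Real.log 3 = 0) : a = 0 ∧ b = 0 := by
  have h' : (a : ℝ) * Real.log 2 = ((-b : ℚ) : ℝ) * Real.log 3 := by
    push_cast
    linear_combination h
  obtain ⟨h1, h2⟩ := rat_mul_log_two_eq_rat_mul_log_three h'
  exact ⟨h1, neg_eq_zero.mp h2⟩

/-! ## §1 Brownawell–Waldschmidt richness of the exponential MODULE -/

/-- **Module form of B–W richness.**  Mod the tree theorem `smallTrdeg_thm_2_9_two_two`: if the field
`K_z = ℚ(z, e^z)` of an arbitrary tuple `z` contains, UP TO ALGEBRAIC ELEMENTS, a Brownawell–Waldschmidt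
configuration — `x` with `(1, x)` ℚ-free, `y₁, y₂` ℚ-free with `e^{y₁}, e^{y₂} ∈ ℚ̄`, and `e^{x y₁}`,
`e^{x y₂}` — i.e. `x, y₁, y₂, e^{xy₁}, e^{xy₂}` are algebraic over `K_z`, then `2 ≤ trdeg_ℚ K_z`.
Round 7's `two_le_trdeg_of_bwGrid` is the sub-case where the four corners `y₁, y₂, xy₁, xy₂` lie in
`span_ℚ z`; here they only lie in the exponential module `Λ(K_z)`.
[cite: BakerTNT1975, Ch. 12 Theorem 12.2] [cite: NesterenkoPhilippon2001, Ch. 14 Theorem 2.9 (Moreover)] -/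
theorem two_le_trdeg_of_bwModule (hBW : smallTrdeg_thm_2_9_two_two) {ι : Type*} (z : ι → ℂ)
    (x y₁ y₂ : ℂ) (hx : LinearIndependent ℚ ![(1 : ℂ), x]) (hy : LinearIndependent ℚ ![y₁, y₂])
    (ha₁ : IsAlgebraic ℚ (cexp y₁)) (ha₂ : IsAlgebraic ℚ (cexp y₂))
    (hxF : IsAlgebraic ↥(adjoin ℚ (Set.range z ∪ Set.range (cexp ∘ z))) x)
    (hy₁F : IsAlgebraic ↥(adjoin ℚ (Set.range z ∪ Set.range (cexp ∘ z))) y₁)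
    (hy₂F : IsAlgebraic ↥(adjoin ℚ (Set.range z ∪ Set.range (cexp ∘ z))) y₂)
    (he₁ : IsAlgebraic ↥(adjoin ℚ (Set.range z ∪ Set.range (cexp ∘ z))) (cexp (x * y₁)))
    (he₂ : IsAlgebraic ↥(adjoin ℚ (Set.range z ∪ Set.range (cexp ∘ z))) (cexp (x * y₂))) :
    (2 : Cardinal) ≤ Algebra.trdeg ℚ ↥(adjoin ℚ (Set.range z ∪ Set.range (cexp ∘ z))) := by
  set xv : Fin 2 → ℂ := ![(1 : ℂ), x] with hxv
  set yv : Fin 2 → ℂ := ![y₁, y₂] with hyv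
  set F : IntermediateField ℚ ℂ := adjoin ℚ (Set.range z ∪ Set.range (cexp ∘ z)) with hF
  have hBW2 := hBW xv yv hx hy (by simpa [hxv, hyv] using ha₁) (by simpa [hxv, hyv] using ha₂)
  refine hBW2.trans ?_
  show Algebra.trdeg ℚ ↥(adjoin ℚ (Set.range xv ∪ Set.range yv ∪
      Set.range (fun p : Fin 2 × Fin 2 => cexp (xv p.1 * yv p.2)))) ≤ Algebra.trdeg ℚ ↥F
  apply trdeg_adjoin_le_of_isAlgebraic
  rintro t ((⟨i, rfl⟩ | ⟨j, rfl⟩) | ⟨⟨i, j⟩, rfl⟩)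
  · fin_cases i
    · simpa [hxv] using (isAlgebraic_one : IsAlgebraic ℚ (1 : ℂ)).tower_top (L := ↥F)
    · simpa [hxv] using hxF
  · fin_cases j
    · simpa [hyv] using hy₁F
    · simpa [hyv] using hy₂F
  · fin_cases i <;> fin_cases j
    · simpa [hxv, hyv] using ha₁.tower_top (L := ↥F)
    · simpa [hxv, hyv] using ha₂.tower_top (L := ↥F)
    · simpa [hxv, hyv] using he₁
    · simpa [hxv, hyv] using he₂

/-! ## §2 The twisted-log-pair cell -/

/-- **TWISTED LOG PAIRS.**  Mod `smallTrdeg_thm_2_9_two_two`: if `span_ℚ z` contains `μ l₁` and `μ l₂`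
for ℚ-free logarithms of algebraic numbers `l₁, l₂` and a multiplier `μ` with `(1, μ)` ℚ-free, and
`μ ∈ K_z` (e.g. because `span_ℚ z` also contains some nonzero `m ∈ span_ℚ(l₁, l₂)`), then
`2 ≤ trdeg_ℚ K_z`.  The B–W configuration `{l₁, l₂, μl₁, μl₂}` lies in the exponential module of `K_z`
(`lᵢ = (μ lᵢ)/μ ∈ K_z`, `e^{lᵢ} ∈ ℚ̄`) but in general NOT in `span_ℚ z` (§3: `iπ ∉ span z♯`).
[cite: BakerTNT1975, Ch. 12 Theorem 12.2] -/
theorem two_le_trdeg_of_twistedLogPair (hBW : smallTrdeg_thm_2_9_two_two) {ι : Type*} (z : ι → ℂ)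
    (l₁ l₂ μ : ℂ) (hl : LinearIndependent ℚ ![l₁, l₂]) (hμ : LinearIndependent ℚ ![(1 : ℂ), μ])
    (ha₁ : IsAlgebraic ℚ (cexp l₁)) (ha₂ : IsAlgebraic ℚ (cexp l₂))
    (hμF : μ ∈ adjoin ℚ (Set.range z ∪ Set.range (cexp ∘ z)))
    (h₁ : μ * l₁ ∈ Submodule.span ℚ (Set.range z)) (h₂ : μ * l₂ ∈ Submodule.span ℚ (Set.range z)) :
    (2 : Cardinal) ≤ Algebra.trdeg ℚ ↥(adjoin ℚ (Set.range z ∪ Set.range (cexp ∘ z))) := by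
  set F : IntermediateField ℚ ℂ := adjoin ℚ (Set.range z ∪ Set.range (cexp ∘ z)) with hF
  have hμ0 : μ ≠ 0 := by simpa using hμ.ne_zero 1
  have hl₁F : l₁ ∈ F := by
    have : l₁ = (μ * l₁) * μ⁻¹ := by field_simp
    rw [this]
    exact mul_mem (mem_adjoin_of_mem_span h₁) (inv_mem hμF)
  have hl₂F : l₂ ∈ F := by
    have : l₂ = (μ * l₂) * μ⁻¹ := by field_simp
    rw [this]
    exact mul_mem (mem_adjoin_of_mem_span h₂) (inv_mem hμF)
  exact two_le_trdeg_of_bwModule hBW z μ l₁ l₂ hμ hl ha₁ ha₂ (isAlgebraic_of_mem_adjoin hμF)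
    (isAlgebraic_of_mem_adjoin hl₁F) (isAlgebraic_of_mem_adjoin hl₂F)
    (exp_isAlgebraic_of_mem_span h₁) (exp_isAlgebraic_of_mem_span h₂)

/-- **`S⁻`-reading at length 3**: a twisted log pair inside the span of a TRIPLE decides
`DefectOneSchanuel` there (`3 ≤ trdeg + 1`), whatever the multiplication type. -/
theorem defectOne_three_of_twistedLogPair (hBW : smallTrdeg_thm_2_9_two_two) (z : Fin 3 → ℂ)
    (l₁ l₂ μ : ℂ) (hl : LinearIndependent ℚ ![l₁, l₂]) (hμ : LinearIndependent ℚ ![(1 : ℂ), μ])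
    (ha₁ : IsAlgebraic ℚ (cexp l₁)) (ha₂ : IsAlgebraic ℚ (cexp l₂))
    (hμF : μ ∈ adjoin ℚ (Set.range z ∪ Set.range (cexp ∘ z)))
    (h₁ : μ * l₁ ∈ Submodule.span ℚ (Set.range z)) (h₂ : μ * l₂ ∈ Submodule.span ℚ (Set.range z)) :
    ((3 : ℕ) : Cardinal) ≤ Algebra.trdeg ℚ ↥(adjoin ℚ (Set.range z ∪ Set.range (cexp ∘ z))) + 1 := by
  have h := add_le_add (two_le_trdeg_of_twistedLogPair hBW z l₁ l₂ μ hl hμ ha₁ ha₂ hμF h₁ h₂)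
    (le_rfl : (1 : Cardinal) ≤ 1)
  have h21 : (2 : Cardinal) + 1 = ((3 : ℕ) : Cardinal) := by norm_num
  rwa [h21] at h

/-! ## §5 Theorem 2.9 (`t₂`) richness of the exponential module -/

/-- **Module form of `t₂`-richness** (the `GridRich` sector of crux `SchanuelTwo`, lifted to any length).
Mod the tree theorem `smallTrdeg_thm_2_9_pos`: if `K_z` contains up to algebraic elements a `(d, ℓ)` grid
`x, y, e^{xᵢyⱼ}` with `x`, `y` ℚ-free and `ℓ + d < dℓ`, then `2 ≤ trdeg_ℚ K_z`.  Round 7's grids IN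
THE SPAN (`plainDefectOne_four_grid_blind`) are the sub-case `xᵢ yⱼ ∈ span_ℚ z`; a sub-minimal failure is
blind to those, not to grids in the module of a non-saturated tuple.
[cite: NesterenkoPhilippon2001, Ch. 14 Theorem 2.9] -/
theorem two_le_trdeg_of_t2Module (h29 : smallTrdeg_thm_2_9_pos) {ι : Type*} (z : ι → ℂ) {d l : ℕ}
    (x : Fin d → ℂ) (y : Fin l → ℂ) (hx : LinearIndependent ℚ x) (hy : LinearIndependent ℚ y)
    (hdl : l + d < d * l)
    (hxF : ∀ i, IsAlgebraic ↥(adjoin ℚ (Set.range z ∪ Set.range (cexp ∘ z))) (x i))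
    (hyF : ∀ j, IsAlgebraic ↥(adjoin ℚ (Set.range z ∪ Set.range (cexp ∘ z))) (y j))
    (heF : ∀ i j, IsAlgebraic ↥(adjoin ℚ (Set.range z ∪ Set.range (cexp ∘ z))) (cexp (x i * y j))) :
    (2 : Cardinal) ≤ Algebra.trdeg ℚ ↥(adjoin ℚ (Set.range z ∪ Set.range (cexp ∘ z))) := by
  refine (h29.two_le_trdeg_gridField₂ x y hx hy hdl).trans ?_
  show Algebra.trdeg ℚ ↥(adjoin ℚ (Set.range x ∪ Set.range y ∪
      Set.range (fun p : Fin d × Fin l => cexp (x p.1 * y p.2)))) ≤ _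
  apply trdeg_adjoin_le_of_isAlgebraic
  rintro t ((⟨i, rfl⟩ | ⟨j, rfl⟩) | ⟨⟨i, j⟩, rfl⟩)
  · exact hxF i
  · exact hyF j
  · exact heF i j

/-! ## §6 The `n = 3` layer of stmt-31410: sub-minimality is automatic; the PAIR CRITERION;
`SchanuelTwo ⇒ PlainDefectOne(3)` -/

/-- **SUB-MINIMALITY IS AUTOMATIC AT LENGTH 3**: every ℚ-free tuple of length `≤ 2` satisfies `S⁻`
(Hermite–Lindemann), so the sub-minimality hypothesis of stmt-31409/31410 is vacuous for triples. -/
theorem subMinimal_three (z : Fin 3 → ℂ) : ∀ (m : ℕ) (w : Fin m → ℂ), m < 3 → LinearIndependent ℚ w →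
    (∀ j, w j ∈ Submodule.span ℚ (Set.range z)) →
    (m : Cardinal) ≤ Algebra.trdeg ℚ ↥(adjoin ℚ (Set.range w ∪ Set.range (cexp ∘ w))) + 1 :=
  fun m w hm hw _ => defectOne_of_le_two m (by omega) w hw

/-- Hence the `n = 3` layer of `PlainDefectOne` (stmt-31410) is exactly `S⁻` ON PLAIN ℚ-FREE TRIPLES. -/
theorem plainDefectOne_three_iff :
    (∀ z : Fin 3 → ℂ, LinearIndependent ℚ z →
      (∀ β : ℂ, IsAlgebraic ℚ β → (∀ i, β * z i ∈ Submodule.span ℚ (Set.range z)) →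
        β ∈ Set.range (algebraMap ℚ ℂ)) →
      (∀ (m : ℕ) (w : Fin m → ℂ), m < 3 → LinearIndependent ℚ w →
        (∀ j, w j ∈ Submodule.span ℚ (Set.range z)) →
        (m : Cardinal) ≤ Algebra.trdeg ℚ ↥(adjoin ℚ (Set.range w ∪ Set.range (cexp ∘ w))) + 1) →
      ((3 : ℕ) : Cardinal) ≤ Algebra.trdeg ℚ ↥(adjoin ℚ (Set.range z ∪ Set.range (cexp ∘ z))) + 1) ↔
    (∀ z : Fin 3 → ℂ, LinearIndependent ℚ z →
      (∀ β : ℂ, IsAlgebraic ℚ β → (∀ i, β * z i ∈ Submodule.span ℚ (Set.range z)) →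
        β ∈ Set.range (algebraMap ℚ ℂ)) →
      ((3 : ℕ) : Cardinal) ≤ Algebra.trdeg ℚ ↥(adjoin ℚ (Set.range z ∪ Set.range (cexp ∘ z))) + 1) :=
  ⟨fun h z hz hp => h z hz hp (subMinimal_three z), fun h z hz hp _ => h z hz hp⟩

/-- `1 ≤ trdeg ℚ(z₀, e^{z₀})` for `z₀ ≠ 0` (Hermite–Lindemann, tree theorem `transcendental_exp_holds`). -/
theorem one_le_trdeg_single {z₀ : ℂ} (h0 : z₀ ≠ 0) :
    (1 : Cardinal) ≤ Algebra.trdeg ℚ ↥(adjoin ℚ ({z₀, cexp z₀} : Set ℂ)) := by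
  by_cases halg : IsAlgebraic ℚ z₀
  · exact one_le_trdeg_adjoin_of_transcendental (transcendental_exp_holds halg h0) (by simp)
  · exact one_le_trdeg_adjoin_of_transcendental halg (by simp)

/-- The pair `(z₀, z₁)` lies in `span_ℚ z`. -/
theorem pair01_mem_span (z : Fin 3 → ℂ) :
    ∀ j, (![z 0, z 1] : Fin 2 → ℂ) j ∈ Submodule.span ℚ (Set.range z) := by
  intro j
  fin_cases j
  · exact Submodule.subset_span ⟨0, by simp⟩
  · exact Submodule.subset_span ⟨1, by simp⟩

/-- The pair `(z₀, z₂)` lies in `span_ℚ z`. -/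
theorem pair02_mem_span (z : Fin 3 → ℂ) :
    ∀ j, (![z 0, z 2] : Fin 2 → ℂ) j ∈ Submodule.span ℚ (Set.range z) := by
  intro j
  fin_cases j
  · exact Submodule.subset_span ⟨0, by simp⟩
  · exact Submodule.subset_span ⟨2, by simp⟩

/-- A transcendence degree `< 2` of a field is `≤ 1`. -/
theorem trdeg_le_one_of_lt_two {L : IntermediateField ℚ ℂ} (h : ¬ (2 : Cardinal) ≤ Algebra.trdeg ℚ ↥L) :
    Algebra.trdeg ℚ ↥L ≤ ((1 : ℕ) : Cardinal) := by
  have h' : Algebra.trdeg ℚ ↥L < ((2 : ℕ) : Cardinal) := by exact_mod_cast not_le.mp h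
  obtain ⟨t, ht, heq⟩ :=
    Summit.Schanuel.Schanuel.Theorems.RootDecomp1EAnchor.exists_nat_lt_of_lt_natCast h'
  rw [heq]
  exact_mod_cast (by omega : t ≤ 1)

/-- **PAIR CRITERION.**  For a ℚ-free triple `z`, `S⁻` holds at `z` (`trdeg K_z ≥ 2`) iff `SchanuelTwo`'s
inequality holds at one of the two pairs `(z₀, z₁)`, `(z₀, z₂)`: if both pair fields have transcendence
degree `1`, each is algebraic over `ℚ(z₀, e^{z₀})` (which already has `trdeg ≥ 1` by Hermite–Lindemann),
hence so is `K_z`, and `trdeg K_z ≤ 1`.  STRUCTURAL READING: `S⁻(3)` fails at `z` iff the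
`SchanuelTwo`-failure partners of `z₀` span, with `z₀`, a space of dimension `≥ 3`; so `S⁻(3)` says that the
failure partners of every `z₀` lie on ONE plane through `z₀`, where `SchanuelTwo` says there are none. -/
theorem two_le_trdeg_three_iff_pairs (z : Fin 3 → ℂ) (hz : LinearIndependent ℚ z) :
    (2 : Cardinal) ≤ Algebra.trdeg ℚ ↥(adjoin ℚ (Set.range z ∪ Set.range (cexp ∘ z))) ↔
      (2 : Cardinal) ≤ Algebra.trdeg ℚ
          ↥(adjoin ℚ (Set.range ![z 0, z 1] ∪ Set.range (cexp ∘ ![z 0, z 1]))) ∨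
        (2 : Cardinal) ≤ Algebra.trdeg ℚ
          ↥(adjoin ℚ (Set.range ![z 0, z 2] ∪ Set.range (cexp ∘ ![z 0, z 2]))) := by
  constructor
  · intro h
    by_contra hor
    have h1 := fun h' => hor (Or.inl h')
    have h2 := fun h' => hor (Or.inr h')
    have hT1 := trdeg_le_one_of_lt_two h1
    have hT2 := trdeg_le_one_of_lt_two h2
    set S : Set ℂ := {z 0, cexp (z 0)} with hS
    have h0 : z 0 ≠ 0 := hz.ne_zero 0
    have hS1 : ((1 : ℕ) : Cardinal) ≤ Algebra.trdeg ℚ ↥(adjoin ℚ S) := by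
      exact_mod_cast one_le_trdeg_single h0
    have hS_T1 : S ⊆ Set.range ![z 0, z 1] ∪ Set.range (cexp ∘ ![z 0, z 1]) := by
      intro x hx
      simp only [hS, Set.mem_insert_iff, Set.mem_singleton_iff] at hx
      rcases hx with rfl | rfl
      · exact Or.inl ⟨0, by simp⟩
      · exact Or.inr ⟨0, by simp⟩
    have hS_T2 : S ⊆ Set.range ![z 0, z 2] ∪ Set.range (cexp ∘ ![z 0, z 2]) := by
      intro x hx
      simp only [hS, Set.mem_insert_iff, Set.mem_singleton_iff] at hx
      rcases hx with rfl | rfl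
      · exact Or.inl ⟨0, by simp⟩
      · exact Or.inr ⟨0, by simp⟩
    have halg : ∀ x ∈ Set.range z ∪ Set.range (cexp ∘ z), IsAlgebraic ↥(adjoin ℚ S) x := by
      rintro x (⟨i, rfl⟩ | ⟨i, rfl⟩)
      · fin_cases i
        · exact Summit.Schanuel.Schanuel.Theorems.RootDecomp1EAnchor.isAlgebraic_of_trdeg_sandwich
            (subset_adjoin ℚ _ (Or.inl ⟨0, by simp⟩)) hS_T1 hT1 hS1
        · exact Summit.Schanuel.Schanuel.Theorems.RootDecomp1EAnchor.isAlgebraic_of_trdeg_sandwich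
            (subset_adjoin ℚ _ (Or.inl ⟨1, by simp⟩)) hS_T1 hT1 hS1
        · exact Summit.Schanuel.Schanuel.Theorems.RootDecomp1EAnchor.isAlgebraic_of_trdeg_sandwich
            (subset_adjoin ℚ _ (Or.inl ⟨1, by simp⟩)) hS_T2 hT2 hS1
      · fin_cases i
        · exact Summit.Schanuel.Schanuel.Theorems.RootDecomp1EAnchor.isAlgebraic_of_trdeg_sandwich
            (subset_adjoin ℚ _ (Or.inr ⟨0, by simp⟩)) hS_T1 hT1 hS1
        · exact Summit.Schanuel.Schanuel.Theorems.RootDecomp1EAnchor.isAlgebraic_of_trdeg_sandwich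
            (subset_adjoin ℚ _ (Or.inr ⟨1, by simp⟩)) hS_T1 hT1 hS1
        · exact Summit.Schanuel.Schanuel.Theorems.RootDecomp1EAnchor.isAlgebraic_of_trdeg_sandwich
            (subset_adjoin ℚ _ (Or.inr ⟨1, by simp⟩)) hS_T2 hT2 hS1
    have hle : Algebra.trdeg ℚ ↥(adjoin ℚ (Set.range z ∪ Set.range (cexp ∘ z))) ≤
        Algebra.trdeg ℚ ↥(adjoin ℚ S) :=
      trdeg_adjoin_le_of_isAlgebraic halg
    have hSle : Algebra.trdeg ℚ ↥(adjoin ℚ S) ≤ ((1 : ℕ) : Cardinal) :=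
      (trdeg_mono (adjoin.mono ℚ _ _ hS_T1)).trans hT1
    have h21 : (2 : Cardinal) ≤ ((1 : ℕ) : Cardinal) := h.trans (hle.trans hSle)
    have : (2 : ℕ) ≤ 1 := by exact_mod_cast h21
    omega
  · rintro (h | h)
    · exact h.trans (trdeg_le_of_mem_span (pair01_mem_span z))
    · exact h.trans (trdeg_le_of_mem_span (pair02_mem_span z))

/-- The first pair of a ℚ-free triple is ℚ-free. -/
theorem pair01_linearIndependent (z : Fin 3 → ℂ) (hz : LinearIndependent ℚ z) :
    LinearIndependent ℚ ![z 0, z 1] := by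
  have : (![z 0, z 1] : Fin 2 → ℂ) = z ∘ Fin.castSucc := by
    funext j
    fin_cases j <;> simp
  rw [this]
  exact hz.comp _ (Fin.castSucc_injective 2)

end Summit.Schanuel.Schanuel.Theorems.RootDecomp1EModuleGrids
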